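import Summits.Ventures.PercRepro.ProfilePointedCircuitClassesSevenC

/-!
# PercRepro — THE IN–OUT INEQUALITY AT `ρ = 7`, IV: THE DOUBLE COUNTING ON ELEVEN POINTS
(p5, gen 41; `proofs/P5-GM1.md` §61)

`M` is a loopless matroid of rank `4` on `11` points (the dual of a coloop-free matroid of rank `7` and nullity `4`)
and `e` a point.  DEMANDS: the bases `W ∋ e` with `E ∖ W` spanning (`in_4(e)` of the primal); UNITS: the spanning
`5`-sets `S ∌ e` with `E ∖ S` spanning (`out_5(e)`); `W ∼ S` when `W ∩ S = ∅`, and `W` CHARGES `S` when moreover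
`(E ∖ W) ∖ S` is a parallel pair.  For a demand `W`, `B := E ∖ W` is a spanning `7`-set, its neighbours are the
spanning `5`-subsets of `B` and the units it charges are at least the parallel pairs `Y ⊆ B` with `B ∖ Y`
spanning: `30 ≤ 3·s(W) + 2·c(W)` (part II).  For a unit `S`, `T := (E ∖ S) − e` has five points, its neighbours
`W ↦ W − e` are `3`-subsets of `T` of rank `3` and the demands charging it have `T ∖ (W − e)` parallel:
`2·c'(S) + 3·p(S) ≤ 30` (part III).  Counting both relations from both sides,
`30·#𝒟 ≤ Σ_W (3s + 2c) = Σ_S (3p + 2c') ≤ 30·#𝒰`: **`card_demands_le_card_units_of_eleven`**.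
-/

open scoped Matroid

namespace PercRepro.Cogirth

open Finset ThmH Skew Shadow Profile

variable {α : Type} [DecidableEq α] {M : Matroid α} [M.Finite]

section SevenD

/-- **THE IN–OUT INEQUALITY ON ELEVEN POINTS, IN THE DUAL**: in a loopless matroid of rank `4` on `11` points,
the bases through `e` with spanning complement are at most the spanning `5`-sets avoiding `e` with spanning
complement. -/
theorem card_demands_le_card_units_of_eleven (hR : rk M (gr M) = 4) (hll : ∀ x ∈ gr M, rk M {x} = 1)
    (hn : (gr M).card = 11) {e : α} (he : e ∈ gr M) :
    (((gr M).powersetCard 4).filter (fun W => e ∈ W ∧ rk M W = 4 ∧ rk M (gr M \ W) = 4)).card ≤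
      (((gr M).powersetCard 5).filter (fun S => e ∉ S ∧ rk M S = 4 ∧ rk M (gr M \ S) = 4)).card := by
  set D := ((gr M).powersetCard 4).filter (fun W => e ∈ W ∧ rk M W = 4 ∧ rk M (gr M \ W) = 4) with hDdef
  set U := ((gr M).powersetCard 5).filter (fun S => e ∉ S ∧ rk M S = 4 ∧ rk M (gr M \ S) = 4) with hUdef
  -- (1) the two relations, counted from both sides
  have hdc1 : ∑ W ∈ D, (U.filter (fun S => W ∩ S = ∅)).card =
      ∑ S ∈ U, (D.filter (fun W => W ∩ S = ∅)).card := by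
    have h := sum_card_bipartiteAbove_eq_sum_card_bipartiteBelow
      (r := fun (W S : Finset α) => W ∩ S = ∅) (s := D) (t := U)
    simp only [bipartiteAbove, bipartiteBelow] at h
    exact h
  have hdc2 : ∑ W ∈ D, (U.filter (fun S => W ∩ S = ∅ ∧ rk M ((gr M \ W) \ S) ≤ 1)).card =
      ∑ S ∈ U, (D.filter (fun W => W ∩ S = ∅ ∧ rk M ((gr M \ W) \ S) ≤ 1)).card := by
    have h := sum_card_bipartiteAbove_eq_sum_card_bipartiteBelow
      (r := fun (W S : Finset α) => W ∩ S = ∅ ∧ rk M ((gr M \ W) \ S) ≤ 1) (s := D) (t := U)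
    simp only [bipartiteAbove, bipartiteBelow] at h
    exact h
  -- (2) every demand: `30 ≤ 3·s(W) + 2·c(W)`
  have hW : ∀ W ∈ D, 30 ≤ 3 * (U.filter (fun S => W ∩ S = ∅)).card +
      2 * (U.filter (fun S => W ∩ S = ∅ ∧ rk M ((gr M \ W) \ S) ≤ 1)).card := by
    intro W hW
    rw [hDdef, mem_filter, mem_powersetCard] at hW
    obtain ⟨⟨hWg, hW4⟩, heW, hWr, hWc⟩ := hW
    have hBg : gr M \ W ⊆ gr M := sdiff_subset
    have hB7 : (gr M \ W).card = 7 := by rw [card_sdiff_of_subset hWg, hn, hW4]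
    have hmain := thirty_le_three_mul_card_add_two_mul_card hR hll hBg hB7 hWc
    -- `s(W) = σ₅(E ∖ W)`
    have hs : U.filter (fun S => W ∩ S = ∅) = ((gr M \ W).powersetCard 5).filter (fun X => rk M X = 4) := by
      ext S
      rw [mem_filter, hUdef, mem_filter, mem_powersetCard, mem_filter, mem_powersetCard]
      constructor
      · rintro ⟨⟨⟨hSg, hS5⟩, _, hSr, _⟩, hWS⟩
        refine ⟨⟨?_, hS5⟩, hSr⟩
        intro x hx
        rw [mem_sdiff]
        refine ⟨hSg hx, fun hxW => ?_⟩
        have : x ∈ W ∩ S := mem_inter.2 ⟨hxW, hx⟩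
        rw [hWS] at this
        exact notMem_empty x this
      · rintro ⟨⟨hSB, hS5⟩, hSr⟩
        have hWS : W ∩ S = ∅ := by
          rw [eq_empty_iff_forall_notMem]
          intro x hx
          rw [mem_inter] at hx
          exact (mem_sdiff.1 (hSB hx.2)).2 hx.1
        refine ⟨⟨⟨hSB.trans sdiff_subset, hS5⟩, fun heS => (mem_sdiff.1 (hSB heS)).2 heW, hSr, ?_⟩, hWS⟩
        have h1 : W ⊆ gr M \ S := by
          intro x hx
          rw [mem_sdiff]
          exact ⟨hWg hx, fun hxS => (mem_sdiff.1 (hSB hxS)).2 hx⟩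
        have h2 := rk_mono' (M := M) h1
        have h3 : rk M (gr M \ S) ≤ rk M (gr M) := rk_le_rk_gr sdiff_subset
        omega
    -- `c(W) ≥ q(E ∖ W)`
    have hc : ((gr M \ W).powersetCard 2).filter (fun Y => rk M Y ≤ 1 ∧ rk M ((gr M \ W) \ Y) = 4) ⊆
        ((gr M \ W).powersetCard 2) := filter_subset _ _
    have hcle : (((gr M \ W).powersetCard 2).filter
        (fun Y => rk M Y ≤ 1 ∧ rk M ((gr M \ W) \ Y) = 4)).card ≤
        (U.filter (fun S => W ∩ S = ∅ ∧ rk M ((gr M \ W) \ S) ≤ 1)).card := by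
      apply card_le_card_of_injOn (fun Y => (gr M \ W) \ Y)
      · intro Y hY
        rw [mem_coe, mem_filter, mem_powersetCard] at hY
        obtain ⟨⟨hYB, hY2⟩, hYr, hYc⟩ := hY
        rw [mem_coe, mem_filter, hUdef, mem_filter, mem_powersetCard]
        dsimp only
        refine ⟨⟨⟨sdiff_subset.trans sdiff_subset, ?_⟩, ?_, hYc, ?_⟩, ?_, ?_⟩
        · rw [card_sdiff_of_subset hYB, hB7, hY2]
        · intro h
          exact (mem_sdiff.1 (mem_sdiff.1 h).1).2 heW
        · have h1 : W ⊆ gr M \ ((gr M \ W) \ Y) := by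
            intro x hx
            rw [mem_sdiff, mem_sdiff, mem_sdiff]
            exact ⟨hWg hx, fun h => h.1.2 hx⟩
          have h2 := rk_mono' (M := M) h1
          have h3 : rk M (gr M \ ((gr M \ W) \ Y)) ≤ rk M (gr M) := rk_le_rk_gr sdiff_subset
          omega
        · rw [eq_empty_iff_forall_notMem]
          intro x hx
          rw [mem_inter, mem_sdiff, mem_sdiff] at hx
          exact hx.2.1.2 hx.1
        · rw [Finset.sdiff_sdiff_eq_self hYB]
          exact hYr
      · intro Y hY Y' hY' h
        rw [mem_coe, mem_filter, mem_powersetCard] at hY hY'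
        simp only at h
        rw [← Finset.sdiff_sdiff_eq_self hY.1.1, ← Finset.sdiff_sdiff_eq_self hY'.1.1, h]
    rw [hs]
    omega
  -- (3) every unit: `2·c'(S) + 3·p(S) ≤ 30`
  have hS : ∀ S ∈ U, 2 * (D.filter (fun W => W ∩ S = ∅ ∧ rk M ((gr M \ W) \ S) ≤ 1)).card +
      3 * (D.filter (fun W => W ∩ S = ∅)).card ≤ 30 := by
    intro S hS
    rw [hUdef, mem_filter, mem_powersetCard] at hS
    obtain ⟨⟨hSg, hS5⟩, heS, hSr, hSc⟩ := hS
    have heT : e ∈ gr M \ S := mem_sdiff.2 ⟨he, heS⟩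
    have hT5 : ((gr M \ S).erase e).card = 5 := by
      rw [card_erase_of_mem heT, card_sdiff_of_subset hSg, hn, hS5]
    have hmain := two_mul_card_add_three_mul_card_le_thirty (M := M) hT5
    -- the injection `W ↦ W − e`
    have hmaps : ∀ W ∈ D, W ∩ S = ∅ → (W.erase e ⊆ (gr M \ S).erase e ∧ (W.erase e).card = 3 ∧
        rk M (W.erase e) = 3 ∧ ((gr M \ S).erase e) \ W.erase e = (gr M \ W) \ S) := by
      intro W hW hWS
      rw [hDdef, mem_filter, mem_powersetCard] at hW
      obtain ⟨⟨hWg, hW4⟩, heW, hWr, _⟩ := hW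
      refine ⟨?_, ?_, ?_, ?_⟩
      · intro x hx
        rw [mem_erase] at hx
        rw [mem_erase, mem_sdiff]
        refine ⟨hx.1, hWg hx.2, fun hxS => ?_⟩
        have : x ∈ W ∩ S := mem_inter.2 ⟨hx.2, hxS⟩
        rw [hWS] at this
        exact notMem_empty x this
      · rw [card_erase_of_mem heW, hW4]
      · have := rk_eq_card_of_subset_of_rk_eq_card (M := M) (erase_subset e W) (by rw [hWr, hW4])
        rw [this, card_erase_of_mem heW, hW4]
      · ext x
        rw [mem_sdiff, mem_erase, mem_sdiff, mem_erase, mem_sdiff, mem_sdiff]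
        constructor
        · rintro ⟨⟨hxe, hxg, hxS⟩, h⟩
          refine ⟨⟨hxg, fun hxW => h ⟨hxe, hxW⟩⟩, hxS⟩
        · rintro ⟨⟨hxg, hxW⟩, hxS⟩
          exact ⟨⟨fun h => hxW (h ▸ heW), hxg, hxS⟩, fun h => hxW h.2⟩
    have hinj : Set.InjOn (fun W : Finset α => W.erase e)
        ((D.filter (fun W => W ∩ S = ∅) : Finset (Finset α)) : Set (Finset α)) := by
      intro W hW W' hW' h
      rw [mem_coe, mem_filter, hDdef, mem_filter] at hW hW'
      simp only at h
      rw [← insert_erase hW.1.2.1, ← insert_erase hW'.1.2.1, h]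
    have hp : (D.filter (fun W => W ∩ S = ∅)).card ≤
        ((((gr M \ S).erase e).powersetCard 3).filter (fun W₀ => rk M W₀ = 3)).card := by
      apply card_le_card_of_injOn (fun W : Finset α => W.erase e)
      · intro W hW
        rw [mem_coe, mem_filter] at hW
        obtain ⟨h1, h2, h3, _⟩ := hmaps W hW.1 hW.2
        rw [mem_coe, mem_filter, mem_powersetCard]
        exact ⟨⟨h1, h2⟩, h3⟩
      · exact hinj
    have hc' : (D.filter (fun W => W ∩ S = ∅ ∧ rk M ((gr M \ W) \ S) ≤ 1)).card ≤
        ((((gr M \ S).erase e).powersetCard 3).filter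
          (fun W₀ => rk M (((gr M \ S).erase e) \ W₀) ≤ 1)).card := by
      apply card_le_card_of_injOn (fun W : Finset α => W.erase e)
      · intro W hW
        rw [mem_coe, mem_filter] at hW
        obtain ⟨h1, h2, _, h4⟩ := hmaps W hW.1 hW.2.1
        rw [mem_coe, mem_filter, mem_powersetCard, h4]
        exact ⟨⟨h1, h2⟩, hW.2.2⟩
      · intro W hW W' hW' h
        rw [mem_coe, mem_filter] at hW hW'
        exact hinj (mem_coe.2 (mem_filter.2 ⟨hW.1, hW.2.1⟩)) (mem_coe.2 (mem_filter.2 ⟨hW'.1, hW'.2.1⟩)) h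
    omega
  -- (4) sum up
  have h1 : D.card * 30 ≤ ∑ W ∈ D, (3 * (U.filter (fun S => W ∩ S = ∅)).card +
      2 * (U.filter (fun S => W ∩ S = ∅ ∧ rk M ((gr M \ W) \ S) ≤ 1)).card) := by
    have := card_nsmul_le_sum D (fun W => 3 * (U.filter (fun S => W ∩ S = ∅)).card +
      2 * (U.filter (fun S => W ∩ S = ∅ ∧ rk M ((gr M \ W) \ S) ≤ 1)).card) 30 hW
    rw [smul_eq_mul] at this
    exact this
  have h2 : ∑ S ∈ U, (2 * (D.filter (fun W => W ∩ S = ∅ ∧ rk M ((gr M \ W) \ S) ≤ 1)).card +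
      3 * (D.filter (fun W => W ∩ S = ∅)).card) ≤ U.card * 30 := by
    have := sum_le_card_nsmul U (fun S => 2 * (D.filter (fun W => W ∩ S = ∅ ∧ rk M ((gr M \ W) \ S) ≤ 1)).card +
      3 * (D.filter (fun W => W ∩ S = ∅)).card) 30 hS
    rw [smul_eq_mul] at this
    exact this
  rw [sum_add_distrib, ← mul_sum, ← mul_sum, hdc1, hdc2] at h1
  rw [sum_add_distrib, ← mul_sum, ← mul_sum] at h2
  omega

end SevenD

end PercRepro.Cogirth
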